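import Summits.BirchSwinnertonDyer.BirchSwinnertonDyer.Theorems.GoldfeldGoodTwistsX049
import Literature.NumberTheory.EllipticCurves.Kriz2020.CongruentNumberDensityOneProofs
import HarnessLib

/-!
# REVIEW-RUNBOOK sanity lemmas — the twist-counting sets WRITTEN in the density statements are FINITE
# (clients `bsd-goldfeld`, `bsd-cn100` of the ops review-runbook generator; §1 cards, «Conventional values in reach»)

The Goldfeld-type statements of `GoldfeldGoodTwistsX049.lean` and `Kriz2020/CongruentNumberDensityOneProofs.lean`
write densities as `Nat.card {d : ℤ | Squarefree d ∧ |d| ≤ X ∧ …} / Nat.card {d : ℤ | Squarefree d ∧ |d| ≤ X ∧ …}`.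
`Nat.card` of an INFINITE type is the default `0`; the quotient is the intended proportion only because every set
counted is finite — each is cut out of the integer interval `[-X, X]` by further conditions.  This file states that
finiteness for every counted set EXACTLY as the statements print it (same bound names `X`, `d`, `W`), so the runbooks'
S-cards can point at a kernel theorem instead of asking the reader (review-runbook 9.88 «written count» rows).

Review evidence only (topic module, closes no item); no definitions, no `sorry`, standard axioms.
-/

namespace Summit.BirchSwinnertonDyer.Rank1Residual.Runbook

open Literature.NumberTheory.EllipticCurves WeierstrassCurve

/-- Every set `{d : ℤ | Squarefree d ∧ |d| ≤ X ∧ P d}` is finite: it lies in the integer interval `[-X, X]`. [folklore] -/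
theorem setOf_squarefree_abs_le_finite (X : ℕ) (P : ℤ → Prop) :
    {d : ℤ | Squarefree d ∧ |d| ≤ (X : ℤ) ∧ P d}.Finite :=
  (Set.finite_Icc (-(X : ℤ)) (X : ℤ)).subset fun _ hd => Set.mem_Icc.2 (abs_le.1 hd.2.1)

/-- The denominator of the `X₀(49)` twist densities: square-free `d ≡ 1 (mod 4)` with `|d| ≤ X` — finite. [folklore] -/
theorem twistsMod4_finite (X : ℕ) : {d : ℤ | Squarefree d ∧ |d| ≤ (X : ℤ) ∧ d % 4 = 1}.Finite :=
  setOf_squarefree_abs_le_finite X _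

/-- The numerator of `bsdRank_densityOne_twists_of_X049` / `bsdRank_and_goldfeld_twists_of_X049` (rank part of BSD +
finite Sha for the twist `cm7^{(d)}`) — finite. [folklore] -/
theorem twistsMod4_bsdRank_cm7_finite (X : ℕ) :
    {d : ℤ | Squarefree d ∧ |d| ≤ (X : ℤ) ∧ (d % 4 = 1 ∧
      ((cm7.quadraticTwist d).analyticRank = (cm7.quadraticTwist d).mordellWeilRank ∧
        Finite (cm7.quadraticTwist d).sha))}.Finite :=
  setOf_squarefree_abs_le_finite X _

/-- The numerator of `bsdRank_eq_selmerCorank_densityOne_twists_of_X049` (Selmer corank ≤ 1 and both ranks equal to it,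
finite Sha) — finite. [folklore] -/
theorem twistsMod4_bsdRank_eq_selmerCorank_cm7_finite (X : ℕ) :
    {d : ℤ | Squarefree d ∧ |d| ≤ (X : ℤ) ∧ (d % 4 = 1 ∧
      (selmerCorankTwoInfty (cm7.quadraticTwist d) ≤ 1 ∧
        (cm7.quadraticTwist d).analyticRank = selmerCorankTwoInfty (cm7.quadraticTwist d) ∧
        (cm7.quadraticTwist d).mordellWeilRank = selmerCorankTwoInfty (cm7.quadraticTwist d) ∧
        Finite (cm7.quadraticTwist d).sha))}.Finite :=
  setOf_squarefree_abs_le_finite X _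

/-- The rank-`0` half of `bsdRank_and_goldfeld_twists_of_X049` — finite. [folklore] -/
theorem twistsMod4_rankZero_cm7_finite (X : ℕ) :
    {d : ℤ | Squarefree d ∧ |d| ≤ (X : ℤ) ∧ (d % 4 = 1 ∧
      ((cm7.quadraticTwist d).analyticRank = 0 ∧ (cm7.quadraticTwist d).mordellWeilRank = 0 ∧
        Finite (cm7.quadraticTwist d).sha))}.Finite :=
  setOf_squarefree_abs_le_finite X _

/-- The rank-`1` half of `bsdRank_and_goldfeld_twists_of_X049` — finite. [folklore] -/
theorem twistsMod4_rankOne_cm7_finite (X : ℕ) :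
    {d : ℤ | Squarefree d ∧ |d| ≤ (X : ℤ) ∧ (d % 4 = 1 ∧
      ((cm7.quadraticTwist d).analyticRank = 1 ∧ (cm7.quadraticTwist d).mordellWeilRank = 1 ∧
        Finite (cm7.quadraticTwist d).sha))}.Finite :=
  setOf_squarefree_abs_le_finite X _

/-- The numerator of `tendsto_bsdRank` for an ARBITRARY curve `W` (the statement's own binder) — finite. [folklore] -/
theorem twistsMod4_bsdRank_finite (W : WeierstrassCurve ℚ) [W.IsElliptic] (X : ℕ) :
    {d : ℤ | Squarefree d ∧ |d| ≤ (X : ℤ) ∧ (d % 4 = 1 ∧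
      ((W.quadraticTwist d).analyticRank = (W.quadraticTwist d).mordellWeilRank ∧
        Finite (W.quadraticTwist d).sha))}.Finite :=
  setOf_squarefree_abs_le_finite X _

/-- The denominator of `tendsto_card_isCongruentNumber_div_card_mod_eight_of_converse`: square-free `d` with
`|d| ≤ X` in the classes `5, 6, 7 (mod 8)` — finite. [folklore] -/
theorem sqfreeMod8_finite (X : ℕ) :
    {d : ℤ | Squarefree d ∧ |d| ≤ (X : ℤ) ∧
      (d.natAbs % 8 = 5 ∨ d.natAbs % 8 = 6 ∨ d.natAbs % 8 = 7)}.Finite :=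
  setOf_squarefree_abs_le_finite X _

/-- Its numerator (those `d` that are moreover congruent numbers) — finite. [folklore] -/
theorem sqfreeMod8_isCongruentNumber_finite (X : ℕ) :
    {d : ℤ | Squarefree d ∧ |d| ≤ (X : ℤ) ∧
      ((d.natAbs % 8 = 5 ∨ d.natAbs % 8 = 6 ∨ d.natAbs % 8 = 7) ∧ IsCongruentNumber d.natAbs)}.Finite :=
  setOf_squarefree_abs_le_finite X _

end Summit.BirchSwinnertonDyer.Rank1Residual.Runbook
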